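import Mathlib
import HarnessLib
import Summits.CriticalPhenomena.Ising3DConformalLimit.Theorems.HyperoctahedralRPTwoPointKernelOfLimitClauses
import Summits.CriticalPhenomena.Ising3DConformalLimit.Theorems.HarmonicMomentsIsotropyTwoPointAsymptoticIsotropyLatticeIntegral
import Summits.CriticalPhenomena.Ising3DConformalLimit.Theorems.HarmonicMomentsIsotropyTwoPointAsymptoticIsotropyBulk
import Literature.Probability.LatticeModels.HighDimPointwiseTriviality
import Literature.Probability.LatticeModels.CriticalScalingDimension

/-!
# Vague asymptotic isotropy of the critical `ℤ³` two-point function from a scale-covariant limit, III: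
# shell indicators, shell integrals of the kernel, lattice shell sums and the shell ratio
(route HarmonicMomentsIsotropy, support item stmt-CriticalPhenomena-6036 `TwoPointAsymptoticIsotropy`;
helper file 3/6 of the conditional line `ExistsScaleCovariantLimit → TwoPointAsymptoticIsotropy`)

With `K(y) = S₂(0,y)` the two-point kernel of a pointwise scaling limit `S` of the critical `ℤ³`
Ising correlators (scale covariant with dimension `Δ`, so `K` is homogeneous of degree `-2Δ`, and
`1/2 ≤ Δ ≤ 1` by the infrared / Simon–Lieb window):

* `shell[a,b]` denotes (local notation) the indicator of the spherical shell `{a < ‖y‖ ≤ b}` of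
  `ℝ³`; it is continuous off two Lebesgue-null spheres (`ae_continuousAt_shell`), so the bulk
  convergence theorem of file II applies to it: `δ³ρ(δ)² Σ_{a<‖δx‖≤b} ⟨σ₀σ_x⟩_{β_c} → ∫_{a<‖y‖≤b} K`
  (`tendsto_shellSum`);
* `integral_shell_half`: `∫_{1/4<‖y‖≤1/2} K = 2^{2Δ-3} ∫_{1/2<‖y‖≤1} K` (homogeneity and the
  scaling of Lebesgue measure), and `integral_shell_pos`: `∫_{1/2<‖y‖≤1} K > 0`;
* `eventually_shellSum_ratio` — THE SHELL RATIO: since `2^{2Δ-3} ≤ 1/2 < 2/3`, for all small `δ`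
  the inner dyadic lattice shell carries at most `2/3` of the two-point mass of the outer one,
  `Σ_{1/4<‖δx‖≤1/2} ⟨σ₀σ_x⟩ ≤ (2/3) Σ_{1/2<‖δx‖≤1} ⟨σ₀σ_x⟩`. This elementary ratio-limit statement
  replaces regular-variation (Karamata/Potter) bookkeeping in the control of the origin (file IV).

References: W. Feller, *An Introduction to Probability Theory* II (1971), VIII.8 (regular variation,
for orientation only); H. Duminil-Copin, ICM 2022, §8.1. No definitions are introduced.
-/

noncomputable section

namespace Summit.CriticalPhenomena.Ising3DConformalLimit.HarmonicMomentsIsotropyTwoPoint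

open Literature.Probability.LatticeModels MeasureTheory Filter Set Metric
open scoped Topology
open Summit.CriticalPhenomena.Ising3DConformalLimit.HyperoctahedralRPTwoPoint

local notation "E3" => EuclideanSpace ℝ (Fin 3)

/-- The indicator of the spherical shell `{a < ‖y‖ ≤ b}`. -/
local notation3 (prettyPrint := false) "shell[" a "," b "]" =>
  Set.indicator {y : EuclideanSpace ℝ (Fin 3) | a < ‖y‖ ∧ ‖y‖ ≤ b} (fun _ => (1:ℝ))

/-- The indicator of the closed ball `{‖y‖ ≤ r}`. -/
local notation3 (prettyPrint := false) "ballInd[" r "]" =>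
  Set.indicator {y : EuclideanSpace ℝ (Fin 3) | ‖y‖ ≤ r} (fun _ => (1:ℝ))

variable {ρ : ℝ → ℝ} {Δ : ℝ} {S : CorrFamily 3}

/-! ### Shell indicators -/

/-- `|shell| ≤ 1`. [folklore] -/
theorem abs_shell_le (a b : ℝ) (y : E3) : |shell[a, b] y| ≤ 1 := by
  have h := norm_indicator_le_norm_self (fun _ : E3 => (1:ℝ)) (s := {y : E3 | a < ‖y‖ ∧ ‖y‖ ≤ b}) y
  rwa [Real.norm_eq_abs, norm_one] at h

/-- `0 ≤ shell`. [folklore] -/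
theorem shell_nonneg (a b : ℝ) (y : E3) : 0 ≤ shell[a, b] y :=
  Set.indicator_nonneg (fun _ _ => zero_le_one) _

/-- `shell = 0` inside radius `a`. [folklore] -/
theorem shell_eq_zero_of_lt {a b : ℝ} {y : E3} (hy : ‖y‖ < a) : shell[a, b] y = 0 :=
  indicator_of_notMem (fun h => absurd h.1 (not_lt.2 hy.le)) _

/-- `shell = 0` outside radius `b`. [folklore] -/
theorem shell_eq_zero_of_gt {a b : ℝ} {y : E3} (hy : b < ‖y‖) : shell[a, b] y = 0 :=
  indicator_of_notMem (fun h => absurd h.2 (not_le.2 hy)) _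

/-- `shell` is continuous off the two spheres `‖y‖ = a`, `‖y‖ = b`. [folklore] -/
theorem continuousAt_shell {a b : ℝ} {y : E3} (ha : ‖y‖ ≠ a) (hb : ‖y‖ ≠ b) :
    ContinuousAt (shell[a, b]) y := by
  by_cases hmem : a < ‖y‖ ∧ ‖y‖ ≤ b
  · -- interior point: locally `1`
    have hlt : ‖y‖ < b := lt_of_le_of_ne hmem.2 hb
    have hev : (shell[a, b]) =ᶠ[𝓝 y] fun _ => (1:ℝ) := by
      have hopen : IsOpen {z : E3 | a < ‖z‖ ∧ ‖z‖ < b} :=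
        (isOpen_lt continuous_const continuous_norm).inter (isOpen_lt continuous_norm continuous_const)
      filter_upwards [hopen.mem_nhds ⟨hmem.1, hlt⟩] with z hz
      exact indicator_of_mem (show z ∈ {y : E3 | a < ‖y‖ ∧ ‖y‖ ≤ b} from ⟨hz.1, hz.2.le⟩) _
    exact hev.continuousAt
  · -- exterior point: locally `0`
    have hev : (shell[a, b]) =ᶠ[𝓝 y] fun _ => (0:ℝ) := by
      rcases not_and_or.1 hmem with h1 | h2
      · have hlt : ‖y‖ < a := lt_of_le_of_ne (not_lt.1 h1) ha
        filter_upwards [(isOpen_lt continuous_norm continuous_const).mem_nhds hlt] with z hz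
        exact shell_eq_zero_of_lt hz
      · have hgt : b < ‖y‖ := not_le.1 h2
        filter_upwards [(isOpen_lt continuous_const continuous_norm).mem_nhds hgt] with z hz
        exact shell_eq_zero_of_gt hz
    exact hev.continuousAt

/-- `shell` is continuous almost everywhere (spheres are Lebesgue-null). [folklore] -/
theorem ae_continuousAt_shell (a b : ℝ) :
    ∀ᵐ y ∂(volume : Measure E3), ContinuousAt (shell[a, b]) y := by
  have ha : (volume : Measure E3) (sphere (0:E3) a) = 0 := Measure.addHaar_sphere volume 0 a
  have hb : (volume : Measure E3) (sphere (0:E3) b) = 0 := Measure.addHaar_sphere volume 0 b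
  have hnull : (volume : Measure E3) (sphere (0:E3) a ∪ sphere (0:E3) b) = 0 :=
    measure_union_null ha hb
  rw [ae_iff]
  refine measure_mono_null (fun y hy => ?_) hnull
  by_contra hmem
  simp only [mem_union, mem_sphere_iff_norm, sub_zero, not_or] at hmem
  exact hy (continuousAt_shell hmem.1 hmem.2)

/-- Rescaling a shell: `shell[a,b](2y) = shell[a/2, b/2](y)`. [folklore] -/
theorem shell_two_smul (a b : ℝ) (y : E3) : shell[a, b] ((2:ℝ) • y) = shell[a / 2, b / 2] y := by
  have hn : ‖(2:ℝ) • y‖ = 2 * ‖y‖ := by rw [norm_smul, Real.norm_eq_abs, abs_of_pos two_pos]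
  have hiff : (a < 2 * ‖y‖ ∧ 2 * ‖y‖ ≤ b) ↔ (a / 2 < ‖y‖ ∧ ‖y‖ ≤ b / 2) := by
    constructor <;> rintro ⟨h1, h2⟩ <;> constructor <;> linarith
  simp only [Set.indicator_apply, mem_setOf_eq, hn, hiff]

/-! ### Shell integrals of the kernel -/

/-- The closed shell `{ε ≤ ‖y‖ ≤ M}` is compact. [folklore] -/
theorem isCompact_closedShell (ε M : ℝ) : IsCompact {y : E3 | ε ≤ ‖y‖ ∧ ‖y‖ ≤ M} := by
  refine Metric.isCompact_of_isClosed_isBounded ?_ ?_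
  · exact (isClosed_le continuous_const continuous_norm).inter
      (isClosed_le continuous_norm continuous_const)
  · refine (isBounded_closedBall (x := (0 : E3)) (r := M)).subset ?_
    intro y hy
    rw [mem_closedBall, dist_zero_right]
    exact hy.2

/-- A function continuous off the origin is integrable on every shell `{a < ‖y‖ ≤ b}` with `a > 0`,
against any weight continuous on the closed shell. [folklore] -/
theorem integrable_shell_mul {a b : ℝ} {g : E3 → ℝ}
    (hg : ContinuousOn g {y : E3 | a ≤ ‖y‖ ∧ ‖y‖ ≤ b}) :
    Integrable (fun y => shell[a, b] y * g y) (volume : Measure E3) := by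
  have hA : MeasurableSet {y : E3 | a < ‖y‖ ∧ ‖y‖ ≤ b} :=
    (measurableSet_lt measurable_const measurable_norm).inter
      (measurableSet_le measurable_norm measurable_const)
  have heq : (fun y => shell[a, b] y * g y) = {y : E3 | a < ‖y‖ ∧ ‖y‖ ≤ b}.indicator g := by
    funext y
    by_cases hy : y ∈ {y : E3 | a < ‖y‖ ∧ ‖y‖ ≤ b}
    · rw [indicator_of_mem hy, indicator_of_mem hy, one_mul]
    · rw [indicator_of_notMem hy, indicator_of_notMem hy, zero_mul]
  rw [heq, integrable_indicator_iff hA]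
  exact ((hg.integrableOn_compact (isCompact_closedShell a b)).mono_set
    fun y hy => ⟨hy.1.le, hy.2⟩)

/-- **Dyadic scaling of the shell integrals.** For a kernel `K(y) = S₂(0,y)` homogeneous of degree
`-2Δ` (scale covariance), `∫_{1/4<‖y‖≤1/2} K = 2^{2Δ-3} ∫_{1/2<‖y‖≤1} K`, written as
`∫ shell[1/4,1/2] K = 8⁻¹ (2⁻¹)^{-2Δ} ∫ shell[1/2,1] K`. [folklore] -/
theorem integral_shell_half (hsc : IsScaleCovariant Δ S) :
    ∫ y, shell[1 / 4, 1 / 2] y * S 2 ![0, y] =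
      8⁻¹ * (2⁻¹ : ℝ) ^ (-(2 * Δ)) * ∫ y, shell[1 / 2, 1] y * S 2 ![0, y] := by
  set f : E3 → ℝ := fun z => shell[1 / 2, 1] z * S 2 ![0, (2⁻¹ : ℝ) • z] with hf
  have h1 : (fun y : E3 => shell[1 / 4, 1 / 2] y * S 2 ![0, y]) = fun y => f ((2:ℝ) • y) := by
    funext y
    simp only [hf, shell_two_smul, smul_smul]
    norm_num
  have h2 : ∫ y : E3, f ((2:ℝ) • y) = |((2:ℝ) ^ 3)⁻¹| * ∫ z, f z := by
    have h := Measure.integral_comp_smul (volume : Measure E3) f 2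
    rw [finrank_euclideanSpace_fin] at h
    rw [h, smul_eq_mul]
  have h3 : (fun z => f z) = fun z => (2⁻¹ : ℝ) ^ (-(2 * Δ)) * (shell[1 / 2, 1] z * S 2 ![0, z]) := by
    funext z
    simp only [hf, kernel_homogeneous hsc (2⁻¹ : ℝ) (by norm_num) z]
    ring
  rw [h1, h2, h3, integral_const_mul]
  norm_num
  ring

/-- The shell integral of a kernel positive and continuous off the origin is positive:
`0 < ∫_{1/2<‖y‖≤1} K`. [folklore] -/
theorem integral_shell_pos (hcont : ContinuousOn (fun y : E3 => S 2 ![0, y]) {0}ᶜ)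
    (hpos : ∀ y : E3, y ≠ 0 → 0 < S 2 ![0, y]) :
    0 < ∫ y, shell[1 / 2, 1] y * S 2 ![0, y] := by
  set y₁ : E3 := EuclideanSpace.single 0 (3 / 4) with hy₁
  have hy₁n : ‖y₁‖ = 3 / 4 := by
    rw [hy₁]
    simp only [EuclideanSpace.single, PiLp.norm_single, Real.norm_eq_abs]
    norm_num
  have hy₁0 : y₁ ≠ 0 := by
    intro h; rw [h, norm_zero] at hy₁n; norm_num at hy₁n
  have hK0 : 0 < S 2 ![0, y₁] := hpos y₁ hy₁0
  -- continuity at `y₁`: `K > K(y₁)/2` on a small ball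
  have hca : ContinuousAt (fun y : E3 => S 2 ![0, y]) y₁ :=
    hcont.continuousAt (isOpen_compl_singleton.mem_nhds hy₁0)
  obtain ⟨r, hr0, hr⟩ : ∃ r > 0, ∀ y ∈ ball y₁ r, S 2 ![0, y₁] / 2 < S 2 ![0, y] := by
    have hev := hca.eventually (lt_mem_nhds (half_lt_self hK0))
    obtain ⟨r, hr0, hr⟩ := Metric.eventually_nhds_iff_ball.1 hev
    exact ⟨r, hr0, hr⟩
  set r₁ : ℝ := min r (1 / 8) with hr₁
  have hr₁0 : 0 < r₁ := lt_min hr0 (by norm_num)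
  have hr₁r : r₁ ≤ r := min_le_left _ _
  have hr₁8 : r₁ ≤ 1 / 8 := min_le_right _ _
  -- the comparison function
  set g : E3 → ℝ := (ball y₁ r₁).indicator fun _ => S 2 ![0, y₁] / 2 with hg
  have hint : Integrable (fun y : E3 => shell[1 / 2, 1] y * S 2 ![0, y]) volume :=
    integrable_shell_mul (hcont.mono fun y hy h0 => by
      have h0' : y = 0 := h0
      have hy1 : 1 / 2 ≤ ‖y‖ := hy.1
      rw [h0', norm_zero] at hy1
      linarith)
  have hle : g ≤ fun y : E3 => shell[1 / 2, 1] y * S 2 ![0, y] := by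
    intro y
    show g y ≤ shell[1 / 2, 1] y * S 2 ![0, y]
    by_cases hy : y ∈ ball y₁ r₁
    · have hdist : ‖y - y₁‖ < r₁ := by rwa [mem_ball, dist_eq_norm] at hy
      have hn1 : 1 / 2 < ‖y‖ := by
        have := norm_sub_norm_le y₁ y
        rw [norm_sub_rev] at this
        linarith
      have hn2 : ‖y‖ ≤ 1 := by
        have := norm_sub_norm_le y y₁
        linarith
      rw [hg, indicator_of_mem hy,
        indicator_of_mem (show y ∈ {y : E3 | 1 / 2 < ‖y‖ ∧ ‖y‖ ≤ 1} from ⟨hn1, hn2⟩), one_mul]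
      exact (hr y (ball_subset_ball hr₁r hy)).le
    · rw [hg, indicator_of_notMem hy]
      by_cases h0 : y = 0
      · rw [h0, shell_eq_zero_of_lt (show ‖(0:E3)‖ < 1 / 2 by rw [norm_zero]; norm_num), zero_mul]
      · exact mul_nonneg (shell_nonneg _ _ _) (hpos y h0).le
  have hg0 : 0 ≤ g := fun y => by
    rw [hg]
    exact Set.indicator_nonneg (fun _ _ => (half_pos hK0).le) _
  have hg_int : ∫ y, g y = (volume : Measure E3).real (ball y₁ r₁) * (S 2 ![0, y₁] / 2) := by
    rw [hg, integral_indicator_const _ measurableSet_ball, smul_eq_mul]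
  have hball : 0 < (volume : Measure E3).real (ball y₁ r₁) :=
    ENNReal.toReal_pos (measure_ball_pos volume y₁ hr₁0).ne' measure_ball_lt_top.ne
  calc (0:ℝ) < ∫ y, g y := by rw [hg_int]; positivity
    _ ≤ ∫ y, shell[1 / 2, 1] y * S 2 ![0, y] :=
        integral_mono_of_nonneg (Eventually.of_forall hg0) hint (Eventually.of_forall hle)

/-! ### Shell sums on the lattice -/

/-- **Convergence of the rescaled lattice shell sums**: for `0 < a < b`,
`δ³ρ(δ)² Σ_{a < ‖δx‖ ≤ b} ⟨σ₀σ_x⟩_{β_c} → ∫_{a<‖y‖≤b} K`. [folklore] -/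
theorem tendsto_shellSum (hlim : HasPointwiseScalingLimit (criticalCorr 3) ρ S) {a b : ℝ}
    (ha : 0 < a) :
    Tendsto (fun δ : ℝ => δ ^ 3 * ρ δ ^ 2 *
        ∑' x : Site 3, shell[a, b] (δ • siteVec x) * criticalTwoPoint 3 x)
      (𝓝[>] (0:ℝ)) (𝓝 (∫ y, shell[a, b] y * S 2 ![0, y])) :=
  tendsto_scaled_latticeSum hlim (B := 1) (abs_shell_le a b) ha
    (fun _ hy => shell_eq_zero_of_lt hy) (fun _ hy => shell_eq_zero_of_gt hy)
    (ae_continuousAt_shell a b)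

/-- The shell sums are nonnegative. [folklore] -/
theorem shellSum_nonneg (a b δ : ℝ) :
    0 ≤ ∑' x : Site 3, shell[a, b] (δ • siteVec x) * criticalTwoPoint 3 x :=
  tsum_nonneg fun x => mul_nonneg (shell_nonneg _ _ _) (criticalTwoPoint_nonneg' x)

/-- **The shell ratio.** If `K = S₂(0,·)` is continuous and positive off `0` and homogeneous of
degree `-2Δ` with `Δ ≤ 1`, then for all small `δ > 0` the inner dyadic lattice shell carries at most
`2/3` of the mass of the outer one:
`Σ_{1/4<‖δx‖≤1/2} ⟨σ₀σ_x⟩ ≤ (2/3) Σ_{1/2<‖δx‖≤1} ⟨σ₀σ_x⟩` (the limiting ratio is `2^{2Δ-3} ≤ 1/2`).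
[folklore] -/
theorem eventually_shellSum_ratio (hρ : ∀ δ ∈ Set.Ioc (0:ℝ) 1, 0 < ρ δ)
    (hlim : HasPointwiseScalingLimit (criticalCorr 3) ρ S) (hsc : IsScaleCovariant Δ S)
    (hΔ : Δ ≤ 1) (hcont : ContinuousOn (fun y : E3 => S 2 ![0, y]) {0}ᶜ)
    (hpos : ∀ y : E3, y ≠ 0 → 0 < S 2 ![0, y]) :
    ∀ᶠ δ in 𝓝[>] (0:ℝ),
      ∑' x : Site 3, shell[1 / 4, 1 / 2] (δ • siteVec x) * criticalTwoPoint 3 x ≤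
        2 / 3 * ∑' x : Site 3, shell[1 / 2, 1] (δ • siteVec x) * criticalTwoPoint 3 x := by
  set J : ℝ := ∫ y, shell[1 / 2, 1] y * S 2 ![0, y] with hJ
  set J' : ℝ := ∫ y, shell[1 / 4, 1 / 2] y * S 2 ![0, y] with hJ'
  have hJpos : 0 < J := integral_shell_pos hcont hpos
  have hJ'le : J' ≤ J / 2 := by
    rw [hJ', integral_shell_half hsc, ← hJ]
    have h4 : (2⁻¹ : ℝ) ^ (-(2 * Δ)) ≤ 4 := by
      rw [Real.inv_rpow (by norm_num), ← Real.rpow_neg (by norm_num), neg_neg]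
      calc (2:ℝ) ^ (2 * Δ) ≤ (2:ℝ) ^ ((2:ℕ):ℝ) :=
            Real.rpow_le_rpow_of_exponent_le (by norm_num) (by push_cast; linarith)
        _ = 4 := by rw [Real.rpow_natCast]; norm_num
    nlinarith
  have hu := tendsto_shellSum hlim (a := 1 / 4) (b := 1 / 2) (by norm_num)
  have hv := tendsto_shellSum hlim (a := 1 / 2) (b := 1) (by norm_num)
  rw [← hJ'] at hu
  rw [← hJ] at hv
  have hu' : ∀ᶠ δ in 𝓝[>] (0:ℝ), δ ^ 3 * ρ δ ^ 2 *
      ∑' x : Site 3, shell[1 / 4, 1 / 2] (δ • siteVec x) * criticalTwoPoint 3 x < 7 * J / 12 :=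
    (tendsto_order.1 hu).2 _ (by linarith)
  have hv' : ∀ᶠ δ in 𝓝[>] (0:ℝ), 7 * J / 8 < δ ^ 3 * ρ δ ^ 2 *
      ∑' x : Site 3, shell[1 / 2, 1] (δ • siteVec x) * criticalTwoPoint 3 x :=
    (tendsto_order.1 hv).1 _ (by linarith)
  have hδ1 : ∀ᶠ δ in 𝓝[>] (0:ℝ), δ < 1 :=
    (eventually_lt_nhds one_pos).filter_mono nhdsWithin_le_nhds
  filter_upwards [hu', hv', hδ1, self_mem_nhdsWithin] with δ h1 h2 h3 hδpos
  have hδ : 0 < δ := hδpos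
  have hc : 0 < δ ^ 3 * ρ δ ^ 2 := mul_pos (pow_pos hδ 3) (pow_pos (hρ δ ⟨hδ, h3.le⟩) 2)
  refine le_of_mul_le_mul_left ?_ hc
  rw [← mul_assoc, mul_comm (δ ^ 3 * ρ δ ^ 2) (2 / 3), mul_assoc]
  linarith

end Summit.CriticalPhenomena.Ising3DConformalLimit.HarmonicMomentsIsotropyTwoPoint

end
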